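import Literature.Topology.FourManifolds.KnotAlexanderPresentation
import Literature.Topology.FourManifolds.SliceKnotsFoxMilnorMetabolizer
import HarnessLib

/-!
# Fox–Milnor from a bicollared Seifert surface, the linking pairing and a metabolizer

Topic `Literature/Topology/FourManifolds`; the Seifert-form proof of the Fox–Milnor theorem
(Fox–Milnor (1966), Thm. 2; Kauffman (1987), Ch. VIII, Thm. 8.2–8.3; Lickorish (1997), Thm. 6.5 with
Ch. 8) assembled down to its three geometric inputs. For a knot `K ⊂ S³`, a circle-valued map
`f : S³ ∖ K → S¹` along which the meridian winds once, and a band about the connected cut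
`L = {f = 1}` (an open Seifert surface) trivialised over the angle (`CircleBandData f`,
`CircleBandCut.lean`), write `Y = {f ≠ 1}` (`= S³ ∖ F`), `N = {f ≠ -1}` (the open bicollar, `≃ L × (-1, 1)`),
`N±` for its two sides and `i± : H₁(N±) → H₁(Y)`, `j± : H₁(N±) ≅ H₁(N)` for the maps induced by the
inclusions.  Suppose given

* **(duality)** an additive pairing `L : H₁(Y; ℤ) × H₁(N; ℤ) → ℤ` which is perfect on the `Y` side
  with respect to a `ℤ`-basis `c₁, …, cₙ` of `H₁(N; ℤ)` — `y ↦ (L(y, cₗ))ₗ` is a bijection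
  `H₁(Y; ℤ) → ℤⁿ` (Alexander duality `H₁(S³ ∖ F) ≅ H¹(F) ≅ Hom(H₁(F), ℤ)`, the linking pairing;
  Rolfsen (1976), §5.D, §8.C; Lickorish (1997), Prop. 6.3 / Thm. 6.5: the basis of `H₁(S³ ∖ F)` dual
  to a basis of `H₁(F)`);
* **(Seifert symmetry)** `L(i₊ p, j₋ q) = L(i₋ q, j₊ p)` — "`lk(a⁺, b) = lk(a, b⁻)`", the identity
  which makes the two push-off matrices mutually transpose (Rolfsen (1976), §8.C; Lickorish (1997),
  Thm. 6.5: the relation matrix is `tV − Vᵀ`);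
* **(metabolizer)** a subgroup `U ≤ H₁(N; ℤ)` of half rank with `L(i₋ q, w) = 0` whenever
  `j₋ q ∈ U` and `w ∈ U` (Kauffman (1987), Ch. VIII, Thm. 8.2: for a slice knot, the kernel of
  `H₁(F) → H₁(M)` for a `3`-manifold `M ⊂ D⁴` bounded by `F` and the slice disc — "half lives, half
  dies" and the vanishing of linking numbers of curves bounding disjoint surfaces in `D⁴`).

Then **every Alexander polynomial `Δ` of `K` has the form `Δ = u · g(t) · g(t⁻¹)`**
(`Knot.TubularNbhd.exists_eq_mul_invert_of_circleBandData_pairing`). Proof: the basis of `H₁(Y)`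
dual to `c` under `L` (perfectness) turns the presentation of the Alexander module assembled in
`KnotAlexanderPresentation.lean` (`Knot.TubularNbhd.exists_alexander_presentation_of_circleBandData`:
relation rows `B − tA`, `A`, `B` the matrices of `i₊`, `i₋`) into one with `B = V`,
`A = Vᵀ` for `V_{tl} = L(i₋ c̃ₜ, cₗ)` (Seifert symmetry), and the metabolizer, read in coordinates,
is a half-rank subgroup of `ℤⁿ` on which `(v, w) ↦ vᵀ V w` vanishes; conclude by
`Knot.exists_eq_mul_invert_of_seifert_presentation` (`SliceKnotsFoxMilnorMetabolizer.lean`: Smith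
normal form and the block determinant, Kauffman Thm. 8.3 (ii)).  What this does NOT provide — the
inputs left as hypotheses, each a classical theorem not yet in the tree for the tree's Seifert
surfaces — is listed above; no named fact is introduced and everything here is proved.

## References

* R. H. Fox, J. W. Milnor, *Singularities of 2-spheres in 4-space and cobordism of knots*, Osaka J.
  Math. 3 (1966), 257–267, Thm. 2. [FoxMilnor1966]
* L. H. Kauffman, *On Knots*, Ann. of Math. Stud. 115 (1987), Ch. VIII, Thm. 8.2, Thm. 8.3.
  [Kauffman1987]
* D. Rolfsen, *Knots and Links*, Publish or Perish (1976), §5.D, §8.C. [Rolfsen1976]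
* W. B. R. Lickorish, *An Introduction to Knot Theory*, GTM 175 (1997), Prop. 6.3, Thm. 6.5, Ch. 8.
  [Lickorish1997]
-/

noncomputable section

open Set Function Matrix
open scoped LaurentPolynomial Real
open Literature.AlgebraicTopology.SingularHomology
open Literature.Topology.FourManifolds.CircleMaps
open Literature.Topology.FourManifolds.CircleMaps.CyclicCover

namespace Literature.Topology.FourManifolds

namespace FoxMilnor

/-! ### Bilinear bookkeeping for an additive pairing -/

/-- Expansion of an additive pairing on integer combinations:
`L(∑ₜ uₜ • pₜ, ∑ₗ wₗ • qₗ) = ∑ₜ ∑ₗ uₜ wₗ L(pₜ, qₗ)`. [folklore] -/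
theorem pairing_sum_zsmul_sum_zsmul {P Q : Type*} [AddCommGroup P] [AddCommGroup Q]
    (L : P →+ Q →+ ℤ) {n m : ℕ} (u : Fin n → ℤ) (p : Fin n → P) (w : Fin m → ℤ) (q : Fin m → Q) :
    L (∑ t, u t • p t) (∑ l, w l • q l) = ∑ t, ∑ l, u t * w l * L (p t) (q l) := by
  rw [map_sum L, AddMonoidHom.finsetSum_apply]
  refine Finset.sum_congr rfl fun t _ => ?_
  rw [map_zsmul L, AddMonoidHom.zsmul_apply, map_sum (L (p t)), smul_eq_mul, Finset.mul_sum]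
  refine Finset.sum_congr rfl fun l _ => ?_
  rw [map_zsmul, smul_eq_mul]
  ring

/-- `v ⬝ᵥ V *ᵥ w = ∑ₜ ∑ₗ vₜ wₗ V_{tl}`. [folklore] -/
theorem dotProduct_mulVec_eq_sum_sum {n : ℕ} (v w : Fin n → ℤ) (V : Matrix (Fin n) (Fin n) ℤ) :
    v ⬝ᵥ V *ᵥ w = ∑ t, ∑ l, v t * w l * V t l := by
  simp only [dotProduct, Matrix.mulVec]
  rw [show (∑ t, v t * ∑ l, V t l * w l) = ∑ t, ∑ l, v t * (V t l * w l) from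
    Finset.sum_congr rfl fun t _ => Finset.mul_sum _ _ _]
  refine Finset.sum_congr rfl fun t _ => Finset.sum_congr rfl fun l _ => ?_
  ring

/-- A `ℤ`-submodule and an additive subgroup with the same elements have the same rank (both
carry the integer-multiple `ℤ`-module structure). [folklore] -/
theorem finrank_eq_finrank_addSubgroup {M : Type*} [AddCommGroup M] [Module ℤ M]
    (S : Submodule ℤ M) (T : AddSubgroup M) (h : ∀ x, x ∈ S ↔ x ∈ T) :
    Module.finrank ℤ S = Module.finrank ℤ T := by
  let ε : S ≃ₗ[ℤ] T :=
    { toFun := fun x => ⟨x.1, (h x.1).1 x.2⟩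
      invFun := fun x => ⟨x.1, (h x.1).2 x.2⟩
      map_add' := fun _ _ => rfl
      map_smul' := fun _ _ => Subtype.ext rfl
      left_inv := fun _ => rfl
      right_inv := fun _ => rfl }
  exact LinearEquiv.finrank_eq ε

end FoxMilnor

namespace Knot.TubularNbhd

open FoxMilnor

variable {K : Knot} (ν : Knot.TubularNbhd K)

set_option maxHeartbeats 1600000 in
/-- **Fox–Milnor from a bicollared Seifert surface, the linking pairing and a metabolizer**
(Fox–Milnor 1966, Thm. 2, along Kauffman 1987, Ch. VIII, Thm. 8.2–8.3 and Rolfsen 1976, §8.C):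
see the module docstring for the three hypotheses (duality), (Seifert symmetry), (metabolizer).
[cite: FoxMilnor1966, Thm. 2] [cite: Kauffman1987, Ch. VIII Thm. 8.2–8.3] [cite: Rolfsen1976, §8.C] -/
theorem exists_eq_mul_invert_of_circleBandData_pairing (f : C(K.complement, Circle))
    (B : CircleBandData f) [PathConnectedSpace ↥{x : K.complement | f x = Circle.exp 0}]
    (h₀ : winding f ν.meridian = 1) {n : ℕ}
    (bN : Module.Basis (Fin n) ℤ (singularHomology ℤ ℤ ↥B.cutData.N 1))
    (L : singularHomology ℤ ℤ ↥B.cutData.Y 1 →+ singularHomology ℤ ℤ ↥B.cutData.N 1 →+ ℤ)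
    (hL : Function.Bijective fun y : singularHomology ℤ ℤ ↥B.cutData.Y 1 => fun l : Fin n => L y (bN l))
    (hadj : ∀ (p : singularHomology ℤ ℤ ↥B.cutData.plus 1) (q : singularHomology ℤ ℤ ↥B.cutData.minus 1),
      L (B.cutData.iPlus ℤ ℤ 1 p) (B.cutData.jMinus ℤ ℤ 1 q) =
        L (B.cutData.iMinus ℤ ℤ 1 q) (B.cutData.jPlus ℤ ℤ 1 p))
    (U : AddSubgroup (singularHomology ℤ ℤ ↥B.cutData.N 1)) (hU : 2 * Module.finrank ℤ U = n)
    (hiso : ∀ q : singularHomology ℤ ℤ ↥B.cutData.minus 1, B.cutData.jMinus ℤ ℤ 1 q ∈ U →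
      ∀ w ∈ U, L (B.cutData.iMinus ℤ ℤ 1 q) w = 0)
    {Δ : ℤ[T;T⁻¹]} (hΔ : K.IsAlexanderPolynomial Δ) :
    ∃ (g : ℤ[T;T⁻¹]) (u : ℤ[T;T⁻¹]ˣ), Δ = ↑u * g * LaurentPolynomial.invert g := by
  -- (1) the basis of `H₁(Y)` dual to `bN` under `L`
  let φ : singularHomology ℤ ℤ ↥B.cutData.Y 1 →ₗ[ℤ] (Fin n → ℤ) :=
    { toFun := fun y l => L y (bN l)
      map_add' := fun y y' => by
        funext l
        simp only [map_add, AddMonoidHom.add_apply, Pi.add_apply]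
      map_smul' := fun r y => by
        funext l
        simp only [RingHom.id_apply, Pi.smul_apply, smul_eq_mul]
        have h := congrArg (fun z => L z (bN l))
          (int_smul_eq_zsmul (inferInstance : Module ℤ (singularHomology ℤ ℤ ↥B.cutData.Y 1)) r y)
        rw [map_zsmul, AddMonoidHom.zsmul_apply, smul_eq_mul] at h
        exact h }
  let eY : singularHomology ℤ ℤ ↥B.cutData.Y 1 ≃ₗ[ℤ] (Fin n → ℤ) := LinearEquiv.ofBijective φ hL
  let bY : Module.Basis (Fin n) ℤ (singularHomology ℤ ℤ ↥B.cutData.Y 1) := Module.Basis.ofEquivFun eY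
  have hbY : ∀ y l, bY.repr y l = L y (bN l) := fun y l => by
    rw [Module.Basis.ofEquivFun_repr_apply]
    rfl
  have expand : ∀ y : singularHomology ℤ ℤ ↥B.cutData.Y 1,
      y = CutData.comb (⇑bY) (fun l => L y (bN l)) := fun y => by
    rw [CutData.comb_apply]
    conv_lhs => rw [← bY.sum_repr y]
    exact Finset.sum_congr rfl fun l _ => by rw [hbY]; exact int_smul_eq_zsmul _ _ _
  -- (2) generators of `H₁(N)` and their lifts to the two sides
  have hexpN : ∀ x : singularHomology ℤ ℤ ↥B.cutData.N 1, x = ∑ l, bN.equivFun x l • bN l := fun x => by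
    conv_lhs => rw [← bN.sum_repr x]
    exact Finset.sum_congr rfl fun l _ => int_smul_eq_zsmul _ _ _
  let c : Fin n → singularHomology ℤ ℤ ↥B.cutData.N 1 := fun t => bN t
  have hc : ∀ x : singularHomology ℤ ℤ ↥B.cutData.N 1, ∃ β : Fin n → ℤ, x = ∑ t, β t • c t := fun x =>
    ⟨fun t => bN.equivFun x t, hexpN x⟩
  let bp : Fin n → singularHomology ℤ ℤ ↥B.cutData.plus 1 := fun t =>
    surjInv (B.jPlus_bijective ℤ ℤ 1).2 (c t)
  let bm : Fin n → singularHomology ℤ ℤ ↥B.cutData.minus 1 := fun t =>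
    surjInv (B.jMinus_bijective ℤ ℤ 1).2 (c t)
  have hbp : ∀ t, B.cutData.jPlus ℤ ℤ 1 (bp t) = c t := fun t => surjInv_eq (B.jPlus_bijective ℤ ℤ 1).2 (c t)
  have hbm : ∀ t, B.cutData.jMinus ℤ ℤ 1 (bm t) = c t := fun t => surjInv_eq (B.jMinus_bijective ℤ ℤ 1).2 (c t)
  -- (3) the Seifert matrix `V_{tl} = L(i₋ c̃ₜ, cₗ)`; by the symmetry the matrix of `i₊` is `Vᵀ`
  let V : Matrix (Fin n) (Fin n) ℤ := Matrix.of fun t l => L (B.cutData.iMinus ℤ ℤ 1 (bm t)) (bN l)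
  have hB : ∀ t, B.cutData.iMinus ℤ ℤ 1 (bm t) = CutData.comb (⇑bY) (V t) := fun t =>
    expand _
  have hA : ∀ t, B.cutData.iPlus ℤ ℤ 1 (bp t) = CutData.comb (⇑bY) (Vᵀ t) := fun t => by
    refine (expand (B.cutData.iPlus ℤ ℤ 1 (bp t))).trans ?_
    congr 1
    funext l
    change L _ (bN l) = L (B.cutData.iMinus ℤ ℤ 1 (bm l)) (bN t)
    have h1 : (bN l : singularHomology ℤ ℤ ↥B.cutData.N 1) = B.cutData.jMinus ℤ ℤ 1 (bm l) := (hbm l).symm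
    have h2 : (bN t : singularHomology ℤ ℤ ↥B.cutData.N 1) = B.cutData.jPlus ℤ ℤ 1 (bp t) := (hbp t).symm
    rw [h1, h2, hadj]
  -- (4) the presentation of the Alexander module with rows `V − tVᵀ`
  obtain ⟨e', pres, -, hsurj, hker⟩ := ν.exists_alexander_presentation_of_circleBandData f B h₀ bY c hc
    bp bm hbp hbm Vᵀ V hA hB
  rw [Matrix.transpose_map] at hker
  -- (5) the metabolizer in coordinates
  let f₀ : singularHomology ℤ ℤ ↥B.cutData.N 1 →+ (Fin n → ℤ) :=
    (bN.equivFun : _ ≃ₗ[ℤ] (Fin n → ℤ)).toLinearMap.toAddMonoidHom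
  have hf₀ : Function.Injective f₀ := bN.equivFun.injective
  obtain ⟨U', hU'mem⟩ : ∃ U' : Submodule ℤ (Fin n → ℤ), ∀ v, v ∈ U' ↔ v ∈ U.map f₀ :=
    ⟨{ carrier := U.map f₀
       add_mem' := fun ha hb => AddSubgroup.add_mem _ ha hb
       zero_mem' := AddSubgroup.zero_mem _
       smul_mem' := fun r _ hx => AddSubgroup.zsmul_mem _ hx r }, fun v => Iff.rfl⟩
  have hU' : 2 * Module.finrank ℤ U' = n := by
    rw [finrank_eq_finrank_addSubgroup U' (U.map f₀) hU'mem,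
      ← LinearEquiv.finrank_eq (U.equivMapOfInjective f₀ hf₀).toIntLinearEquiv]
    exact hU
  have hiso' : ∀ v ∈ U', ∀ w ∈ U', v ⬝ᵥ V *ᵥ w = 0 := by
    intro v hv w hw
    rw [hU'mem, AddSubgroup.mem_map] at hv hw
    obtain ⟨v₀, hv₀, rfl⟩ := hv
    obtain ⟨w₀, hw₀, rfl⟩ := hw
    -- the lift `q = ∑ₜ vₜ • c̃ₜ` of `v₀` to the minus side
    obtain ⟨q, hq⟩ : ∃ q : singularHomology ℤ ℤ ↥B.cutData.minus 1, q = ∑ t, bN.equivFun v₀ t • bm t :=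
      ⟨_, rfl⟩
    have hjq : B.cutData.jMinus ℤ ℤ 1 q = v₀ := by
      rw [hq, map_sum]
      conv_rhs => rw [hexpN v₀]
      exact Finset.sum_congr rfl fun t _ => by rw [map_zsmul, hbm]
    have key := hiso q (hjq ▸ hv₀) w₀ hw₀
    have hiq : B.cutData.iMinus ℤ ℤ 1 q = ∑ t, bN.equivFun v₀ t • B.cutData.iMinus ℤ ℤ 1 (bm t) := by
      rw [hq, map_sum]
      exact Finset.sum_congr rfl fun t _ => map_zsmul _ _ _
    rw [hiq] at key
    conv at key => rw [hexpN w₀]; rw [pairing_sum_zsmul_sum_zsmul]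
    change bN.equivFun v₀ ⬝ᵥ V *ᵥ bN.equivFun w₀ = 0
    rw [dotProduct_mulVec_eq_sum_sum]
    simpa only [V, Matrix.of_apply] using key
  -- (6) conclude by the algebraic half
  exact K.exists_eq_mul_invert_of_seifert_presentation ν.basePoint e' pres hsurj V hker U' hU' hiso' hΔ

end Knot.TubularNbhd

end Literature.Topology.FourManifolds
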